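import Summits.HodgeConjecture.HodgeCM.StubTree.ThetaSpanFromBMM_2

/-! PORT of `HodgeCM/StubTree/ThetaSpanFromBMM.lean` (HodgeCMPerL run 82) — part 3: continuation of `Summits.HodgeConjecture.HodgeCM.StubTree.ThetaSpanFromBMM_2` (split at a top-level declaration boundary by port_pkg.py; scope re-opened below; declarations unchanged). -/

-- port_pkg: scope re-opened for this part (file-level context, then the namespace/section stack open at the cut)
set_option autoImplicit false
noncomputable section
open scoped Matrix
open NumberField NumberField.InfinitePlace
namespace HodgeCM
open Literature.AlgebraicGeometry.Motives (CMType)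
open Literature.AlgebraicGeometry.ShimuraVarieties (conjRingHomK embedding_conjRingHomK)
namespace Universe
variable {U : Universe}
variable (U)
/-- The same under the PerL binders. -/
def BMMPerL (T : U.ThetaModel) : Prop :=
  ∀ (K L : CMField) (j : K →+* L), IsNormalClosure ℚ K L →
    Module.finrank ℚ K = 6 → (Module.finrank ℚ L = 24 ∨ Module.finrank ℚ L = 48) →
    ∀ (φ : Fin 3 → (K →+* ℂ)), IsFrame φ →
    ∀ (ι₁ : L →+* ℂ), ι₁.comp j = φ 0 →
    ∀ (t : Fin 4 → CMType K), IsPerLTypes φ t →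
    ∀ V : HermSpace3 L ι₁,
      U.UisoDisjoint V ∧ ∃ BD : U.BMMDict V, BD.Standard T ∧ (∀ Γ, (BD.X Γ).Cor79) ∧
        BD.Homogeneous ∧ BD.SignForcing T ∧ BD.ThetaOfLine T

/-- **The BMM package with THE OBSTRUCTION split into its printed ingredients** (`TypeMatch ∧ SignMatch` in place
of `SignForcing`): the PRINT-FACING form, every conjunct P / P-IF / MODEL / DESIGN. -/
def BMMMatchFace (T : U.ThetaModel) : Prop :=
  ∀ (F : CMField), IsGalois ℚ F → 6 ≤ Module.finrank ℚ F →
    ∀ (f : Face F) (ι₁ : F →+* ℂ), f.Admissible ι₁ → ∀ V : HermSpace3 F ι₁,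
      U.UisoDisjoint V ∧ ∃ BD : U.BMMDict V, BD.Standard T ∧ (∀ Γ, (BD.X Γ).Cor79) ∧
        BD.Homogeneous ∧ BD.TypeMatch T ∧ BD.SignMatch T ∧ BD.ThetaOfLine T

/-- The same under the PerL binders. -/
def BMMMatchPerL (T : U.ThetaModel) : Prop :=
  ∀ (K L : CMField) (j : K →+* L), IsNormalClosure ℚ K L →
    Module.finrank ℚ K = 6 → (Module.finrank ℚ L = 24 ∨ Module.finrank ℚ L = 48) →
    ∀ (φ : Fin 3 → (K →+* ℂ)), IsFrame φ →
    ∀ (ι₁ : L →+* ℂ), ι₁.comp j = φ 0 →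
    ∀ (t : Fin 4 → CMType K), IsPerLTypes φ t →
    ∀ V : HermSpace3 L ι₁,
      U.UisoDisjoint V ∧ ∃ BD : U.BMMDict V, BD.Standard T ∧ (∀ Γ, (BD.X Γ).Cor79) ∧
        BD.Homogeneous ∧ BD.TypeMatch T ∧ BD.SignMatch T ∧ BD.ThetaOfLine T

variable {U} in
/-- (Ported verbatim from the HodgeCMPerL package; no docstring in the source.) -/
theorem bmmFace_of_match {T : U.ThetaModel} (h : U.BMMMatchFace T) : U.BMMFace T := by
  intro F hG hdeg f ι₁ hadm V
  obtain ⟨hI, BD, hBD, hB, hHom, hT, hS, hTL⟩ := h F hG hdeg f ι₁ hadm V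
  exact ⟨hI, BD, hBD, hB, hHom, BD.signForcing_of_match hT hS, hTL⟩

variable {U} in
/-- (Ported verbatim from the HodgeCMPerL package; no docstring in the source.) -/
theorem bmmPerL_of_match {T : U.ThetaModel} (h : U.BMMMatchPerL T) : U.BMMPerL T := by
  intro K L j hN hK hL φ hφ ι₁ hι₁ t ht V
  obtain ⟨hI, BD, hBD, hB, hHom, hT, hS, hTL⟩ := h K L j hN hK hL φ hφ ι₁ hι₁ t ht V
  exact ⟨hI, BD, hBD, hB, hHom, BD.signForcing_of_match hT hS, hTL⟩

/-- **(CG) for faces** — the context-glue half of generation 6's residual, verbatim (`ThetaModel.ContextGlue`),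
untouched by this file. -/
def ContextGlueFace (T : U.ThetaModel) : Prop :=
  ∀ (F : CMField), IsGalois ℚ F → 6 ≤ Module.finrank ℚ F →
    ∀ (f : Face F) (ι₁ : F →+* ℂ), f.Admissible ι₁ → ∀ V : HermSpace3 F ι₁, T.ContextGlue V F f.psi ι₁

/-- (CG) under the PerL binders. -/
def ContextGluePerL (T : U.ThetaModel) : Prop :=
  ∀ (K L : CMField) (j : K →+* L), IsNormalClosure ℚ K L →
    Module.finrank ℚ K = 6 → (Module.finrank ℚ L = 24 ∨ Module.finrank ℚ L = 48) →
    ∀ (φ : Fin 3 → (K →+* ℂ)), IsFrame φ →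
    ∀ (ι₁ : L →+* ℂ), ι₁.comp j = φ 0 →
    ∀ (t : Fin 4 → CMType K), IsPerLTypes φ t →
    ∀ V : HermSpace3 L ι₁, T.ContextGlue V K t (φ 0)

variable {U} {Hk : U.HeckeData} {T : U.ThetaModel}

/-- Generation 6's residual for faces from the BMM package, (CG), and the two DESIGN facts of the sign recipe. -/
theorem thetaSpanFace_of_bmm (hH : U.Fact_pull_hodge) (hκ : T.Design_kappaConj) (hs : T.Design_frameSignConj)
    (hX : U.BMMFace T) (hCG : U.ContextGlueFace T) : U.ThetaSpanFace T := by
  intro F hG hdeg f ι₁ hadm V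
  obtain ⟨hI, BD, hBD, hB, hHom, hSF, hTL⟩ := hX F hG hdeg f ι₁ hadm V
  obtain ⟨D₀, hD₀⟩ := T.exists_seesawDatum_constructed hκ hs (RingHom.id F) ι₁ f.psi (pairSum_psi f)
  have hctx : ∃ D₀ : StubTree.SeesawDatum F, T.GoodCtx ι₁ ⟨F, f.psi, ι₁, D₀⟩ :=
    ⟨D₀, pairSum_psi f, StubTree.psi_injective F f, admissible_mem_psi f ι₁ hadm,
      RingHom.id F, RingHom.comp_id ι₁, hD₀⟩
  exact ⟨T.thetaSpan_of_bmm V hH hBD hB hI hHom hSF hTL hctx, hCG F hG hdeg f ι₁ hadm V⟩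

/-- Generation 6's residual under the PerL binders from the BMM package, (CG), and the two DESIGN facts. -/
theorem thetaSpanPerL_of_bmm (hH : U.Fact_pull_hodge) (hκ : T.Design_kappaConj) (hs : T.Design_frameSignConj)
    (hX : U.BMMPerL T) (hCG : U.ContextGluePerL T) : U.ThetaSpanPerL T := by
  intro K L j hN hK hL φ hφ ι₁ hι₁ t ht V
  obtain ⟨hI, BD, hBD, hB, hHom, hSF, hTL⟩ := hX K L j hN hK hL φ hφ ι₁ hι₁ t ht V
  have hΨ : PairSum t := StubTree.pairSum_of_isPerLTypes K φ hφ hK t ht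
  obtain ⟨D₀, hD₀⟩ := T.exists_seesawDatum_constructed hκ hs j ι₁ t hΨ
  have hmem : ∀ i, φ 0 ∈ (t i).1 := fun i => (ht i 0).mpr (by fin_cases i <;> rfl)
  have hctx : ∃ D₀ : StubTree.SeesawDatum L, T.GoodCtx ι₁ ⟨K, t, φ 0, D₀⟩ :=
    ⟨D₀, hΨ, StubTree.injective_of_isPerLTypes K φ hφ t ht, hmem, j, hι₁, hD₀⟩
  exact ⟨T.thetaSpan_of_bmm V hH hBD hB hI hHom hSF hTL hctx, hCG K L j hN hK hL φ hφ ι₁ hι₁ t ht V⟩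

variable (U)

/-- **COR-CM, generation 7 form of the lineage's headline.**  `HC_CM` from: the model facts `M`; (V)
`Fact_virtualCup11₂` (PRINT); (S) `LiuSupplyFace` (PRINT ∧ `Dict`); the five ISOLATION inputs of the theta model
with `Fact_innerEmb`, `Fact_hodgeRiemann20`; the DESIGN facts `Design_kappaConj`, `Design_frameSignConj`; the
PRINT-INTERFACE datum package `IsoEmbFace Hk T`; the BMM package `BMMFace T` ([BMM16] Cor 7.9 BY NAME ∧ P-IF seams
∧ MODEL ∧ DESIGN ∧ THE OBSTRUCTION `SignForcing`); (CG) `ContextGlueFace T`; Pohlmann; [QW8]+Milne. -/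
theorem COR_CM_of_liu_bmm (M : U.ModelAxioms) (hV : U.Fact_virtualCup11₂) (hL : U.LiuSupplyFace)
    {T : U.ThetaModel} (h₂ : T.Fact_innerEmb) (h₅ : T.Open_thetaSub) (h₇ : T.Open_thetaGen12)
    (h₈ : T.Open_thetaReal34) (h₉ : T.Open_chars) (h₁₀ : T.Open_occ) (hHR : U.Fact_hodgeRiemann20)
    (hκ : T.Design_kappaConj) (hs : T.Design_frameSignConj)
    {Hk : U.HeckeData} (hD : U.IsoEmbFace Hk T) (hX : U.BMMFace T) (hCG : U.ContextGlueFace T)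
    (hPo : U.PohlmannSpan) (hQ : U.Qw8Sufficiency) : U.HC_CM :=
  COR_CM_of_liu_thetaSpan U M hV hL h₂ h₅ h₇ h₈ h₉ h₁₀ hHR hD (thetaSpanFace_of_bmm M.pull_hodge hκ hs hX hCG)
    hPo hQ

/-- **PerL v5 Thm 4.4, generation 7 form.** -/
theorem perL44_of_liu_bmm (M : U.ModelAxioms) (hV : U.Fact_virtualCup11₂) (hL : U.LiuSupplyPerL)
    {T : U.ThetaModel} (h₂ : T.Fact_innerEmb) (h₅ : T.Open_thetaSub) (h₇ : T.Open_thetaGen12)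
    (h₈ : T.Open_thetaReal34) (h₉ : T.Open_chars) (h₁₀ : T.Open_occ) (hHR : U.Fact_hodgeRiemann20)
    (hκ : T.Design_kappaConj) (hs : T.Design_frameSignConj)
    {Hk : U.HeckeData} (hD : U.IsoEmbPerL Hk T) (hX : U.BMMPerL T) (hCG : U.ContextGluePerL T) : U.PerL44 :=
  perL44_of_liu_thetaSpan U M hV hL h₂ h₅ h₇ h₈ h₉ h₁₀ hHR hD (thetaSpanPerL_of_bmm M.pull_hodge hκ hs hX hCG)

/-- **PerL (`W_per^L`), generation 7 form.** -/
theorem perL_of_liu_bmm (M : U.ModelAxioms) (hV : U.Fact_virtualCup11₂) (hL : U.LiuSupplyPerL)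
    {T : U.ThetaModel} (h₂ : T.Fact_innerEmb) (h₅ : T.Open_thetaSub) (h₇ : T.Open_thetaGen12)
    (h₈ : T.Open_thetaReal34) (h₉ : T.Open_chars) (h₁₀ : T.Open_occ) (hHR : U.Fact_hodgeRiemann20)
    (hκ : T.Design_kappaConj) (hs : T.Design_frameSignConj)
    {Hk : U.HeckeData} (hD : U.IsoEmbPerL Hk T) (hX : U.BMMPerL T) (hCG : U.ContextGluePerL T) : U.PerL :=
  perL_of_liu_thetaSpan U M hV hL h₂ h₅ h₇ h₈ h₉ h₁₀ hHR hD (thetaSpanPerL_of_bmm M.pull_hodge hκ hs hX hCG)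

/-- **COR-CM, PRINT-FACING END STATE of the lineage (generation 7)**: as `COR_CM_of_liu_bmm` with THE OBSTRUCTION
`SignForcing` replaced by its two printed ingredients `TypeMatch` ([Liu21] Thm 4.18/Cor 4.20/Def 4.5 ∘ MODEL) and
`SignMatch` (Adams 2007 Prop. 6.6 / Kashiwara–Vergne 1978; [BMM16] §5, §7; = [Liu21] Def 4.12 exact). -/
theorem COR_CM_of_liu_bmmMatch (M : U.ModelAxioms) (hV : U.Fact_virtualCup11₂) (hL : U.LiuSupplyFace)
    {T : U.ThetaModel} (h₂ : T.Fact_innerEmb) (h₅ : T.Open_thetaSub) (h₇ : T.Open_thetaGen12)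
    (h₈ : T.Open_thetaReal34) (h₉ : T.Open_chars) (h₁₀ : T.Open_occ) (hHR : U.Fact_hodgeRiemann20)
    (hκ : T.Design_kappaConj) (hs : T.Design_frameSignConj)
    {Hk : U.HeckeData} (hD : U.IsoEmbFace Hk T) (hX : U.BMMMatchFace T) (hCG : U.ContextGlueFace T)
    (hPo : U.PohlmannSpan) (hQ : U.Qw8Sufficiency) : U.HC_CM :=
  COR_CM_of_liu_bmm U M hV hL h₂ h₅ h₇ h₈ h₉ h₁₀ hHR hκ hs hD (bmmFace_of_match hX) hCG hPo hQ

/-- **PerL v5 Thm 4.4, print-facing end state.** -/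
theorem perL44_of_liu_bmmMatch (M : U.ModelAxioms) (hV : U.Fact_virtualCup11₂) (hL : U.LiuSupplyPerL)
    {T : U.ThetaModel} (h₂ : T.Fact_innerEmb) (h₅ : T.Open_thetaSub) (h₇ : T.Open_thetaGen12)
    (h₈ : T.Open_thetaReal34) (h₉ : T.Open_chars) (h₁₀ : T.Open_occ) (hHR : U.Fact_hodgeRiemann20)
    (hκ : T.Design_kappaConj) (hs : T.Design_frameSignConj)
    {Hk : U.HeckeData} (hD : U.IsoEmbPerL Hk T) (hX : U.BMMMatchPerL T) (hCG : U.ContextGluePerL T) :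
    U.PerL44 :=
  perL44_of_liu_bmm U M hV hL h₂ h₅ h₇ h₈ h₉ h₁₀ hHR hκ hs hD (bmmPerL_of_match hX) hCG

/-- **PerL (`W_per^L`), print-facing end state.** -/
theorem perL_of_liu_bmmMatch (M : U.ModelAxioms) (hV : U.Fact_virtualCup11₂) (hL : U.LiuSupplyPerL)
    {T : U.ThetaModel} (h₂ : T.Fact_innerEmb) (h₅ : T.Open_thetaSub) (h₇ : T.Open_thetaGen12)
    (h₈ : T.Open_thetaReal34) (h₉ : T.Open_chars) (h₁₀ : T.Open_occ) (hHR : U.Fact_hodgeRiemann20)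
    (hκ : T.Design_kappaConj) (hs : T.Design_frameSignConj)
    {Hk : U.HeckeData} (hD : U.IsoEmbPerL Hk T) (hX : U.BMMMatchPerL T) (hCG : U.ContextGluePerL T) : U.PerL :=
  perL_of_liu_bmm U M hV hL h₂ h₅ h₇ h₈ h₉ h₁₀ hHR hκ hs hD (bmmPerL_of_match hX) hCG

end Universe

/-! ## Part D — KERNEL: gluing two seesaw data along their first and second lines (Landherr) and (CG) REDUCED -/

namespace StubTree.SeesawDatum

/-- A conjugation-fixed element of the CM field `L` is real at every complex embedding. -/
theorem im_eq_zero_of_real {L : CMField} (τ : L →+* ℂ) {a : L} (ha : conjRingHomK L a = a) :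
    (τ a).im = 0 := by
  have h : starRingEnd ℂ (τ a) = τ a := by rw [← embedding_conjRingHomK, ha]
  have := congrArg Complex.im h
  rw [Complex.conj_im] at this
  linarith

/-- **KERNEL (Landherr, both directions — PROVED in this package with no hypothesis:
`HodgeCM.lemma33bLandherr_holds`, `HodgeCM.lemma33bLandherr_converse`).**  Two seesaw data whose SECOND lines have
the same signs at every complex embedding can be GLUED: there is a seesaw datum with the first line of the first,
the second line of the second, the third line of the first, and a fourth line with the signs of the fourth line of
the first (`a₃ := a₃ · b₁ / a₁`; equal discriminant classes and signatures, then Landherr's classification). -/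
theorem exists_glue {L : CMField} (Da Db : SeesawDatum L)
    (h1 : ∀ τ : L →+* ℂ, 0 < (τ (Da.a 1)).re ↔ 0 < (τ (Db.a 1)).re) :
    ∃ Dc : SeesawDatum L, Dc.a 0 = Da.a 0 ∧ Dc.a 1 = Db.a 1 ∧ Dc.a 2 = Da.a 2 ∧
      ∀ τ : L →+* ℂ, 0 < (τ (Dc.a 3)).re ↔ 0 < (τ (Da.a 3)).re := by
  classical
  obtain ⟨hmult, z, hz, hdet⟩ := lemma33bLandherr_converse L Da.a Da.a_real Da.a_ne Da.iso
  -- the glued lines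
  let a : Fin 4 → L := ![Da.a 0, Db.a 1, Da.a 2, Da.a 3 * Db.a 1 * (Da.a 1)⁻¹]
  have ha : ∀ i, conjRingHomK L (a i) = a i := by
    intro i
    fin_cases i
    · exact Da.a_real 0
    · exact Db.a_real 1
    · exact Da.a_real 2
    · show conjRingHomK L (Da.a 3 * Db.a 1 * (Da.a 1)⁻¹) = Da.a 3 * Db.a 1 * (Da.a 1)⁻¹
      rw [map_mul, map_mul, map_inv₀, Da.a_real 3, Db.a_real 1, Da.a_real 1]
  have ha0 : ∀ i, a i ≠ 0 := by
    intro i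
    fin_cases i
    · exact Da.a_ne 0
    · exact Db.a_ne 1
    · exact Da.a_ne 2
    · exact mul_ne_zero (mul_ne_zero (Da.a_ne 3) (Db.a_ne 1)) (inv_ne_zero (Da.a_ne 1))
  -- the sign of the fourth glued line is that of `Da.a 3`
  have hsign3 : ∀ τ : L →+* ℂ, 0 < (τ (Da.a 3 * Db.a 1 * (Da.a 1)⁻¹)).re ↔ 0 < (τ (Da.a 3)).re := by
    intro τ
    have i3 := im_eq_zero_of_real τ (Da.a_real 3)
    have ib := im_eq_zero_of_real τ (Db.a_real 1)
    have ia := im_eq_zero_of_real τ (Da.a_real 1)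
    have hane : (τ (Da.a 1)).re ≠ 0 := by
      intro h0
      apply Da.a_ne 1
      have : τ (Da.a 1) = 0 := Complex.ext (by simpa using h0) (by simpa using ia)
      exact (map_eq_zero τ).mp this
    have hbne : (τ (Db.a 1)).re ≠ 0 := by
      intro h0
      apply Db.a_ne 1
      have : τ (Db.a 1) = 0 := Complex.ext (by simpa using h0) (by simpa using ib)
      exact (map_eq_zero τ).mp this
    -- real parts multiply since all imaginary parts vanish
    have hre : (τ (Da.a 3 * Db.a 1 * (Da.a 1)⁻¹)).re =
        (τ (Da.a 3)).re * ((τ (Db.a 1)).re * ((τ (Da.a 1)).re)⁻¹) := by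
      have iinv : (τ ((Da.a 1)⁻¹)).im = 0 := by rw [map_inv₀, Complex.inv_im, ia]; simp
      have rinv : (τ ((Da.a 1)⁻¹)).re = ((τ (Da.a 1)).re)⁻¹ := by
        rw [map_inv₀, Complex.inv_re, Complex.normSq_apply, ia, mul_zero, add_zero]
        field_simp
      rw [map_mul, map_mul, Complex.mul_re, Complex.mul_re, Complex.mul_im, i3, ib, iinv, rinv]
      ring
    -- the quotient `Re τ b₁ / Re τ a₁` is positive: same signs
    have hq : 0 < (τ (Db.a 1)).re * ((τ (Da.a 1)).re)⁻¹ := by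
      rcases lt_or_gt_of_ne hane with hneg | hpos
      · have hbneg : (τ (Db.a 1)).re < 0 := by
          rcases lt_or_gt_of_ne hbne with hb | hb
          · exact hb
          · exact absurd ((h1 τ).mpr hb) (not_lt.mpr hneg.le)
        exact mul_pos_of_neg_of_neg hbneg (inv_lt_zero.mpr hneg)
      · exact mul_pos ((h1 τ).mp hpos) (inv_pos.mpr hpos)
    rw [hre]
    exact ⟨fun h => pos_of_mul_pos_left h hq.le, fun h => mul_pos h hq⟩
  -- signatures and discriminants of the glued planes agree
  have hmult' : ∀ τ : L →+* ℂ,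
      ({decide (0 < (τ (a 0)).re), decide (0 < (τ (a 1)).re)} : Multiset Bool) =
        {decide (0 < (τ (a 2)).re), decide (0 < (τ (a 3)).re)} := by
    intro τ
    show ({decide (0 < (τ (Da.a 0)).re), decide (0 < (τ (Db.a 1)).re)} : Multiset Bool) =
        {decide (0 < (τ (Da.a 2)).re), decide (0 < (τ (Da.a 3 * Db.a 1 * (Da.a 1)⁻¹)).re)}
    rw [show decide (0 < (τ (Db.a 1)).re) = decide (0 < (τ (Da.a 1)).re) from
          (decide_eq_decide.mpr (h1 τ)).symm,
        show decide (0 < (τ (Da.a 3 * Db.a 1 * (Da.a 1)⁻¹)).re) = decide (0 < (τ (Da.a 3)).re) from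
          decide_eq_decide.mpr (hsign3 τ)]
    exact hmult τ
  have hdet' : ∃ w : L, w ≠ 0 ∧ a 0 * a 1 = a 2 * a 3 * (w * conjRingHomK L w) := by
    refine ⟨z, hz, ?_⟩
    show Da.a 0 * Db.a 1 = Da.a 2 * (Da.a 3 * Db.a 1 * (Da.a 1)⁻¹) * (z * conjRingHomK L z)
    calc Da.a 0 * Db.a 1 = Da.a 0 * Da.a 1 * (Da.a 1)⁻¹ * Db.a 1 := by
            rw [mul_inv_cancel_right₀ (Da.a_ne 1)]
      _ = Da.a 2 * Da.a 3 * (z * conjRingHomK L z) * (Da.a 1)⁻¹ * Db.a 1 := by rw [hdet]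
      _ = Da.a 2 * (Da.a 3 * Db.a 1 * (Da.a 1)⁻¹) * (z * conjRingHomK L z) := by ring
  obtain ⟨g, hg⟩ := lemma33bLandherr_holds L a ha ha0 hmult' hdet'
  exact ⟨⟨a, ha, ha0, ⟨g, hg⟩⟩, rfl, rfl, rfl, hsign3⟩

end StubTree.SeesawDatum

namespace Universe

variable {U : Universe}

namespace BMMDict

variable {L : CMField} {ι₁ : L →+* ℂ} {V : HermSpace3 L ι₁} (BD : U.BMMDict V)

/-- **(X4c) DESIGN — the converse model reading of the primitive `T.Theta`**: the slot-`i` theta one-forms of a good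
context `c` at level `Γ` ARE holomorphic theta one-form classes from the `i`-th line `(L, a_i x ȳ)` of `c` (PerL v5
Def 3.2 / §3.2: `Θ_i(c, Γ)` is spanned by the theta lifts `θ_φ(χ')` from `W_i = (L, a_i)`; together with
`ThetaOfLine` and `Open_thetaSub`: `Θ_i(c, Γ) = line(Γ, a_i) ∩ U_{Ψ_i}(Γ)` — the theta one-forms depend on the
context only through `(K, Ψ, σ)` and the line `a_i`, which is the "intended model" sentence of (CG)'s docstring). -/
def LineOfTheta (T : U.ThetaModel) : Prop :=
  ∀ (c : SeesawCtx L), T.GoodCtx ι₁ c → ∀ (i : Fin 4) (Γ : Level V), T.Theta V c i Γ ⊆ BD.line Γ (c.D.a i)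

end BMMDict

namespace ThetaModel

variable (T : U.ThetaModel) {L : CMField} {ι₁ : L →+* ℂ} (V : HermSpace3 L ι₁)

/-- **(CG) REDUCED — context glue from the two DESIGN readings of `T.Theta`, theta-typing (`Open_thetaSub` at `V`,
itself a P-IF consequence of [Liu21] Thm 4.18 in the tree: `ThetaModel.open_thetaSub_of_liu`) and the KERNEL gluing of
seesaw data (`StubTree.SeesawDatum.exists_glue`, Landherr).**  Given good contexts `Da`, `Db` of type `(K, Ψ, σ)`,
glue their data along the first line of `Da` and the second line of `Db`; the glued context is good (same `j`, by
injectivity of `ι₁`; forced signs carried over), and a slot-0 theta one-form of `Da` comes from the line `a₀`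
(`LineOfTheta`), lies in `U_{Ψ₀}` (`Open_thetaSub`), hence is a slot-0 theta one-form of the glued context
(`ThetaOfLine`); likewise for slot 1 and `Db`. -/
theorem contextGlue_of_bmm {BD : U.BMMDict V}
    (h₅ : ∀ c : SeesawCtx L, T.GoodCtx ι₁ c → ∀ (i : Fin 4) (Γ : Level V),
      T.Theta V c i Γ ⊆ U.Uiso Γ c.K (c.Ψ i) c.σ)
    (hTL : BD.ThetaOfLine T) (hLT : BD.LineOfTheta T) (K : CMField) (Ψ : Fin 4 → CMType K) (σ : K →+* ℂ) :
    T.ContextGlue V K Ψ σ := by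
  intro Da Db hDa hDb
  obtain ⟨j, hj, hSa⟩ := hDa.forced
  obtain ⟨j', hj', hSb⟩ := hDb.forced
  have hjj : j' = j := RingHom.ext fun x => ι₁.injective (by
    have := congrArg (fun f : K →+* ℂ => f x) (hj'.trans hj.symm)
    simpa using this)
  subst hjj
  have h1 : ∀ τ : L →+* ℂ, 0 < (τ (Da.a 1)).re ↔ 0 < (τ (Db.a 1)).re := fun τ =>
    (hSa 1 τ).trans (hSb 1 τ).symm
  obtain ⟨Dc, h0, h1', h2, h3⟩ := StubTree.SeesawDatum.exists_glue Da Db h1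
  have hgood : T.GoodCtx ι₁ ⟨K, Ψ, σ, Dc⟩ := by
    refine ⟨hDa.pairSum, hDa.injective, hDa.mem, j', hj', fun i τ => ?_⟩
    fin_cases i
    · show 0 < (τ (Dc.a 0)).re ↔ T.reqPos K L j' ι₁ (Ψ 0) τ = true
      rw [h0]; exact hSa 0 τ
    · show 0 < (τ (Dc.a 1)).re ↔ T.reqPos K L j' ι₁ (Ψ 1) τ = true
      rw [h1']; exact hSb 1 τ
    · show 0 < (τ (Dc.a 2)).re ↔ T.reqPos K L j' ι₁ (Ψ 2) τ = true
      rw [h2]; exact hSa 2 τ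
    · show 0 < (τ (Dc.a 3)).re ↔ T.reqPos K L j' ι₁ (Ψ 3) τ = true
      exact (h3 τ).trans (hSa 3 τ)
  refine ⟨Dc, hgood, fun Γ => ⟨fun θ hθ => ?_, fun θ hθ => ?_⟩⟩
  · have hl : θ ∈ BD.line Γ (Dc.a 0) := by rw [h0]; exact hLT ⟨K, Ψ, σ, Da⟩ hDa 0 Γ hθ
    exact hTL ⟨K, Ψ, σ, Dc⟩ hgood 0 Γ θ hl (h₅ ⟨K, Ψ, σ, Da⟩ hDa 0 Γ hθ)
  · have hl : θ ∈ BD.line Γ (Dc.a 1) := by rw [h1']; exact hLT ⟨K, Ψ, σ, Db⟩ hDb 1 Γ hθ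
    exact hTL ⟨K, Ψ, σ, Dc⟩ hgood 1 Γ θ hl (h₅ ⟨K, Ψ, σ, Db⟩ hDb 1 Γ hθ)

end ThetaModel

/-! ### Part D packages — generation 6's residual (TS) ∧ (CG) DISCHARGED into P / P-IF / MODEL / DESIGN / KERNEL -/

variable (U)

/-- **The BMM–glue package, faces — the lineage's FULLY DISCHARGED print-facing form.**  Under the face binders:
the isotypic pieces are disjoint [MODEL]; there is a dictionary datum with its seams [P-IF], [BMM16] Cor 7.9 for each
spectrum [P, BY NAME], homogeneity [P-IF: Liu21 Thm 4.18], type match [P-IF ∘ MODEL: Liu21 Thm 4.18/Cor 4.20/Def 4.5],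
sign match [P-IF: Adams 2007 §6 / Kashiwara–Vergne 1978; BMM16 §5, §7], and the two DESIGN readings of `T.Theta`
(`ThetaOfLine`, `LineOfTheta`).  NO residual hypothesis of generation 6 survives as a binder: (TS) is
`thetaSpan_of_bmm ∘ signForcing_of_match`, (CG) is `contextGlue_of_bmm`. -/
def BMMGlueFace (T : U.ThetaModel) : Prop :=
  ∀ (F : CMField), IsGalois ℚ F → 6 ≤ Module.finrank ℚ F →
    ∀ (f : Face F) (ι₁ : F →+* ℂ), f.Admissible ι₁ → ∀ V : HermSpace3 F ι₁,
      U.UisoDisjoint V ∧ ∃ BD : U.BMMDict V, BD.Standard T ∧ (∀ Γ, (BD.X Γ).Cor79) ∧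
        BD.Homogeneous ∧ BD.TypeMatch T ∧ BD.SignMatch T ∧ BD.ThetaOfLine T ∧ BD.LineOfTheta T

/-- The same under the PerL binders. -/
def BMMGluePerL (T : U.ThetaModel) : Prop :=
  ∀ (K L : CMField) (j : K →+* L), IsNormalClosure ℚ K L →
    Module.finrank ℚ K = 6 → (Module.finrank ℚ L = 24 ∨ Module.finrank ℚ L = 48) →
    ∀ (φ : Fin 3 → (K →+* ℂ)), IsFrame φ →
    ∀ (ι₁ : L →+* ℂ), ι₁.comp j = φ 0 →
    ∀ (t : Fin 4 → CMType K), IsPerLTypes φ t →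
    ∀ V : HermSpace3 L ι₁,
      U.UisoDisjoint V ∧ ∃ BD : U.BMMDict V, BD.Standard T ∧ (∀ Γ, (BD.X Γ).Cor79) ∧
        BD.Homogeneous ∧ BD.TypeMatch T ∧ BD.SignMatch T ∧ BD.ThetaOfLine T ∧ BD.LineOfTheta T

variable {U} {Hk : U.HeckeData} {T : U.ThetaModel}

/-- Generation 6's residual for faces, BOTH halves, from the BMM–glue package, theta-typing `Open_thetaSub` and the
two DESIGN facts of the sign recipe — no (CG) hypothesis. -/
theorem thetaSpanFace_of_bmmGlue (hH : U.Fact_pull_hodge) (hκ : T.Design_kappaConj) (hs : T.Design_frameSignConj)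
    (h₅ : T.Open_thetaSub) (hX : U.BMMGlueFace T) : U.ThetaSpanFace T := by
  intro F hG hdeg f ι₁ hadm V
  obtain ⟨hI, BD, hBD, hB, hHom, hT, hS, hTL, hLT⟩ := hX F hG hdeg f ι₁ hadm V
  obtain ⟨D₀, hD₀⟩ := T.exists_seesawDatum_constructed hκ hs (RingHom.id F) ι₁ f.psi (pairSum_psi f)
  have hctx : ∃ D₀ : StubTree.SeesawDatum F, T.GoodCtx ι₁ ⟨F, f.psi, ι₁, D₀⟩ :=
    ⟨D₀, pairSum_psi f, StubTree.psi_injective F f, admissible_mem_psi f ι₁ hadm,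
      RingHom.id F, RingHom.comp_id ι₁, hD₀⟩
  exact ⟨T.thetaSpan_of_bmm V hH hBD hB hI hHom (BD.signForcing_of_match hT hS) hTL hctx,
    T.contextGlue_of_bmm V (fun c hc i Γ => h₅ V c hc i Γ) hTL hLT F f.psi ι₁⟩

/-- Generation 6's residual under the PerL binders, BOTH halves, from the BMM–glue package — no (CG) hypothesis. -/
theorem thetaSpanPerL_of_bmmGlue (hH : U.Fact_pull_hodge) (hκ : T.Design_kappaConj) (hs : T.Design_frameSignConj)
    (h₅ : T.Open_thetaSub) (hX : U.BMMGluePerL T) : U.ThetaSpanPerL T := by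
  intro K L j hN hK hL φ hφ ι₁ hι₁ t ht V
  obtain ⟨hI, BD, hBD, hB, hHom, hT, hS, hTL, hLT⟩ := hX K L j hN hK hL φ hφ ι₁ hι₁ t ht V
  have hΨ : PairSum t := StubTree.pairSum_of_isPerLTypes K φ hφ hK t ht
  obtain ⟨D₀, hD₀⟩ := T.exists_seesawDatum_constructed hκ hs j ι₁ t hΨ
  have hmem : ∀ i, φ 0 ∈ (t i).1 := fun i => (ht i 0).mpr (by fin_cases i <;> rfl)
  have hctx : ∃ D₀ : StubTree.SeesawDatum L, T.GoodCtx ι₁ ⟨K, t, φ 0, D₀⟩ :=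
    ⟨D₀, hΨ, StubTree.injective_of_isPerLTypes K φ hφ t ht, hmem, j, hι₁, hD₀⟩
  exact ⟨T.thetaSpan_of_bmm V hH hBD hB hI hHom (BD.signForcing_of_match hT hS) hTL hctx,
    T.contextGlue_of_bmm V (fun c hc i Γ => h₅ V c hc i Γ) hTL hLT K t (φ 0)⟩

variable (U)


-- port_pkg: scope closed for this part
end Universe
end HodgeCM
end
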